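import Mathlib
import Summits.ResolutionOfSingularities.ResolutionOfSingularities.Theses.TropicalLinks
import Summits.ResolutionOfSingularities.ResolutionOfSingularities.Theorems.WeightedInvariantWeightedThesisProjectiveIntegralSuffices
import Summits.ResolutionOfSingularities.ResolutionOfSingularities.Theorems.TropicalLinksInductiveStepOffTropical
import Summits.ResolutionOfSingularities.ResolutionOfSingularities.Theorems.TropicalLinksInductiveStepWeightZero
import Literature.AlgebraicGeometry.Tropical.SchonIdeal
import Literature.AlgebraicGeometry.Tropical.TropicalLink
import Literature.AlgebraicGeometry.Resolution.ProjectiveModels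
import Literature.AlgebraicGeometry.Resolution.ResolutionOfComponents
import Literature.RingTheory.MvPolynomial.WeightMonomialOrder
import Literature.RingTheory.MvPolynomial.LeadingExponents
import Literature.RingTheory.GradedAlgebra.AffineHilbertFunction

/-!
# Line `zariski-toric-closure` for crux `TropicalLinks.SchonResolves` (stmt-ResolutionOfSingularities-17234) —
# registered skeleton (lead gen 1, 2026-08-17)

The crux: for every prime `p`, the typed Tevelev conjecture in every dimension (`SchonAt p d`, all `d`)
implies that every integral separated finite-type scheme over an algebraically closed field of
characteristic `p` has a resolution. Mathematics: Tevelev 2007 (Rem. 3.3, Thm. 1.4, Thm. 1.7) —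
characteristic-free. THIS LINE realises the tropical compactification WITHOUT any toric-variety
definition: the compactification is the schematic closure of a `K`-point in `ℙᴺ ×ₖ X`
(`ProjModel.ofClosure` of the tree), regular chart by chart, dominating `X` through Zariski's
projective models. Architecture memo: `Cruxes/SchonResolves/KERNEL.md` (v1 + v2). Composition
`SchonResolves_of` below is kernel-checked modulo exactly the `stub_*` theorems:

* `stub_veryAffineModel` (B, scheme-level, M): an integral closed subscheme `X ⊆ ℙⁿ_k` is a
  projective model of its function field `K` with a very affine dense open `U = Spec (k[ℤ^M]/ker ev)`
  (`ev : k[ℤ^M] → K`, `x^v ↦ ∏ (x_i/x_0)^{v_i}`), of dimension `d`, and with the `M+1` standard charts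
  `Spec k[x_j/x_i] → X` through which the `K`-point factors.
* `stub_extKernel` (C-glue, S): the extended evaluation `ev' : k[ℤ^(M+m)] → K` (`y_j ↦ ev(G_j)`) has
  kernel the route's extended ideal `I' = ⟨ι(ker ev), y_j − ι G_j⟩` (tree p159774).
* `stub_fan` (D, combinatorics, crux-sized): a smooth projective fan on `ℤ^(M+m)` refining the Gröbner
  fan of the STANDARD homogenisation of `J ∩ k[x]` and the pulled-back fan of `ℙ^M`, exported as finite
  lattice data: vertices `A`, adapted coordinates `φ_a`, covering identities, chart compatibility
  `idx`, and per vertex a monomial order `mo_a` with leading-exponent constancy on the cone (GC).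
* `stub_chartRegular` (F, algebra, L): schön `J` + GC for the cone of `φ` ⇒ the adapted chart
  `k[ℕ^n] ⧸ (φ·J ∩ k[ℕ^n])` is regular (Gröbner freeness/flatness of the degeneration + Matsumura 23.7
  + chart×torus; rays already landed: p167984).
* `stub_chartImage` (glue, S/M): that chart ring is the subalgebra of `K` generated by the monomials
  `t^{A b − A a}`; regularity transfers and the dual-cone monomials lie in it.
* `stub_closureResolves` (E+G, scheme-level, L): if the vertex chart rings `D_a ⊆ K` are regular, map to
  `X` compatibly with the `K`-point, and the vertex charts cover (D2), then `X` has a resolution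
  (`Z := ProjModel.ofClosure` in `ℙᴺ × X`; `Z ∩ (D₊(z_a) × X) = Γ_a(Spec D_a)`; `homOf.hasResolution`).
-/

set_option linter.dupNamespace false

namespace Summit.ResolutionOfSingularities.ResolutionOfSingularities.Cruxes.SchonResolves.ZariskiToricClosure

open scoped Classical
open CategoryTheory AlgebraicGeometry AddMonoidAlgebra
open Literature.AlgebraicGeometry.Resolution Literature.AlgebraicGeometry.Tropical
open Summit.ResolutionOfSingularities.ResolutionOfSingularities.Theses.TropicalLinks
open Summit.ResolutionOfSingularities.ResolutionOfSingularities.Theorems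

/-! ## The stubs -/

/-- **Stub B (very affine model).** An integral closed subscheme `X` of `ℙⁿ_k` is (isomorphic to the
underlying scheme of) a projective model `MX` of a field `K/k`, together with: `M, d : ℕ`, a
`k`-algebra map `ev : k[ℤ^M] → K` (the coordinates `x_i/x_0` of the surviving homogeneous coordinates)
whose kernel is a prime of dimension `d` with fraction field `K`, and the `M+1` standard affine charts
`Spec k[x_j/x_i] → X` (subalgebras `C i` of `K`) over `k` through which the `K`-point factors. -/
theorem stub_veryAffineModel :
    ∀ (k : Type) [Field k] (n : ℕ) (X : AlgebraicGeometry.Scheme.{0}) (ι : X ⟶ (Literature.AlgebraicGeometry.Motives.projectiveSpace n k).left), AlgebraicGeometry.IsClosedImmersion ι → AlgebraicGeometry.IsIntegral X → ∃ (K : Type) (_ : Field K) (_ : Algebra k K) (MX : Literature.AlgebraicGeometry.Resolution.ProjModel k K) (_ : MX.X ≅ X) (M d : ℕ) (ev : AddMonoidAlgebra k (Fin M → ℤ) →ₐ[k] K) (C : Fin (M + 1) → Subalgebra k K), (RingHom.ker ev.toRingHom).IsPrime ∧ ringKrullDim (AddMonoidAlgebra k (Fin M → ℤ) ⧸ RingHom.ker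 ev.toRingHom) = (d : WithBot ℕ∞) ∧ (∀ z : K, ∃ a b : AddMonoidAlgebra k (Fin M → ℤ), ev b ≠ 0 ∧ z * ev b = ev a) ∧ (∀ i : Fin (M + 1), C i = Algebra.adjoin k (Set.range fun j : Fin (M + 1) => ev (AddMonoidAlgebra.single (Fin.cases (0 : Fin M → ℤ) (fun l : Fin M => (Pi.single l 1 : Fin M → ℤ)) j - Fin.cases (0 : Fin M → ℤ) (fun l : Fin M => (Pi.single l 1 : Fin M → ℤ)) i) (1 : k)))) ∧ ∀ i : Fin (M + 1), ∃ g : AlgebraicGeometry.Spec (CommRingCat.of (C i)) ⟶ MX.X, g ≫ MX.π = AlgebraicGeometry.Spec.map (CommRingCat.ofHom (algebraMap k (C i))) ∧ AlgebraicGeometry.Spec.map (CommRingCat.ofHom (C i).val.toRingHom) ≫ g = MX.gen := by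
  sorry

/-- **Stub C-glue (extended evaluation and its kernel).** For `ev : k[ℤ^M] → K` and Laurent
polynomials `G_j` not in its kernel there is the extended evaluation `ev' : k[ℤ^(M+m)] → K`,
`x^{(v,0)} ↦ ev x^v`, `y_j ↦ ev(G_j)`, whose kernel is the route's extended ideal
`⟨ι(ker ev), y_j − ι G_j⟩` (by the presentation `tropicalLinks_extIdeal_presentation`, p159774). -/
theorem stub_extKernel :
    ∀ (k : Type) [Field k] (K : Type) [Field K] [Algebra k K] (M m : ℕ) (ev : AddMonoidAlgebra k (Fin M → ℤ) →ₐ[k] K) (G : Fin m → AddMonoidAlgebra k (Fin M → ℤ)), (∀ j, G j ∉ RingHom.ker ev.toRingHom) → ∃ ev' : AddMonoidAlgebra k (Fin (M + m) → ℤ) →ₐ[k] K, (∀ f : AddMonoidAlgebra k (Fin M → ℤ), ev' (AddMonoidAlgebra.ofCoeff (f.coeff.mapDomain fun v => Fin.append v (0 : Fin m → ℤ))) = ev f) ∧ (∀ j : Fin m, ev' (AddMonoidAlgebra.single (Fin.append (0 : Fin M → ℤ) (Pi.single j (1 : ℤ))) (1 : k)) = ev (G j)) ∧ RingHom.ker ev'.toRingHom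 = Ideal.span ((fun f : AddMonoidAlgebra k (Fin M → ℤ) => (AddMonoidAlgebra.ofCoeff (f.coeff.mapDomain fun v => Fin.append v (0 : Fin m → ℤ)) : AddMonoidAlgebra k (Fin (M + m) → ℤ))) '' (↑(RingHom.ker ev.toRingHom) : Set (AddMonoidAlgebra k (Fin M → ℤ))) ∪ Set.range (fun j : Fin m => AddMonoidAlgebra.single (Fin.append (0 : Fin M → ℤ) (Pi.single j (1 : ℤ))) (1 : k) - AddMonoidAlgebra.ofCoeff ((G j).coeff.mapDomain fun v => Fin.append v (0 : Fin m → ℤ)))) := by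
  sorry

/-- **Stub D (fan theorem).** For an ideal `J` of `k[ℤ^(M+m)]` there is a SMOOTH PROJECTIVE FAN
ADAPTED TO `J` AND TO THE PROJECTION TO THE FIRST `M` COORDINATES, as finite lattice data: an injective
family `A` of lattice points (the lattice points of a smooth polytope) indexed by `Fin (N+1)`, the set
`Vert` of vertex indices, for each vertex `a` a lattice automorphism `φ_a` adapted to the vertex cone
(`φ_a(v)_i = ⟨u_i, v⟩` for the primitive generators `u_i` of the cone), a chart index `idx a` of `ℙ^M`
and a monomial order `mo_a` on `k[x_0..x_n]`, such that: (D1) `A − A a ⊆ φ_a⁻¹(ℕ^n)` and the dual basis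
occurs among the differences; (D2) every `A b` is a rational convex combination of vertices;
(D4) the cone of `a` maps into the `idx a`-th cone of the fan of `ℙ^M`; (GC) for every weight `w` of the
cone of `a` (`w = φ_aᵀ c`, `c ∈ ℕ^n`), the leading exponents of the STANDARD homogenisation
`I^h = transportIdeal (1, x) (J ∩ k[x_1..x_n])` for the weight order "`(0,w)` (min) then `mo_a`" are those
for `mo_a` (the cone lies in a maximal Gröbner cone of `I^h`). Content: Gröbner fan of a Laurent ideal
(Maclagan–Sturmfels §2.5–2.6), state polytope, common refinement, toric resolution by stellar
subdivisions. -/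
theorem stub_fan :
    ∀ (k : Type) [Field k] (M m : ℕ) (J : Ideal (AddMonoidAlgebra k (Fin (M + m) → ℤ))), ∃ (N : ℕ) (A : Fin (N + 1) → (Fin (M + m) → ℤ)) (Vert : Finset (Fin (N + 1))) (φ : Fin (N + 1) → ((Fin (M + m) → ℤ) ≃+ (Fin (M + m) → ℤ))) (idx : Fin (N + 1) → Fin (M + 1)) (mo : Fin (N + 1) → MonomialOrder.{0, 0} (Fin (M + m + 1))), Function.Injective A ∧ (∀ a ∈ Vert, ∀ (b : Fin (N + 1)) (i : Fin (M + m)), 0 ≤ φ a (A b - A a) i) ∧ (∀ a ∈ Vert, ∀ i : Fin (M + m), ∃ b : Fin (N + 1), φ a (A b - A a) = Pi.single i 1) ∧ (∀ b : Fin (N + 1), ∃ (mlt : ℕ) (c : Fin (N + 1) → ℕ), 0 < mlt ∧ (∀ a, c a ≠ 0 → a ∈ Vert) ∧ ∑ a, c a = mlt ∧ mlt • A b = ∑ a, c a • A a) ∧ (∀ a ∈ Vert, ∀ (j : Fin (M + 1)) (i : Fin (M + m)), 0 ≤ φ a (Fin.append (Fin.cases (0 : Fin M → ℤ) (fun l :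 Fin M => (Pi.single l 1 : Fin M → ℤ)) j - Fin.cases (0 : Fin M → ℤ) (fun l : Fin M => (Pi.single l 1 : Fin M → ℤ)) (idx a)) (0 : Fin m → ℤ)) i) ∧ ∀ a ∈ Vert, ∀ c : Fin (M + m) → ℕ, Literature.RingTheory.MvPolynomial.leadingExponents (Literature.RingTheory.MvPolynomial.weightLex (Fin.cases (Finset.univ.sup fun l : Fin (M + m) => (∑ i, (c i : ℤ) * φ a (Pi.single l 1) i).toNat) (fun l : Fin (M + m) => ((Finset.univ.sup fun l : Fin (M + m) => (∑ i, (c i : ℤ) * φ a (Pi.single l 1) i).toNat : ℕ) - ∑ i, (c i : ℤ) * φ a (Pi.single l 1) i).toNat) : Fin (M + m + 1) → ℕ) (mo a)) (Literature.RingTheory.GradedAlgebra.transportIdeal (K := k) (Fin.cases (1 : MvPolynomial (Fin (M + m)) k) (fun i => MvPolynomial.X i) : Fin (M + m + 1) → MvPolynomial (Fin (M + m)) k) (((Literature.AlgebraicGeometry.Tropical.linkIdeal (AddMonoidHom.compLeft (Nat.castAddMonoidHom ℤ) (Fin (M + m))) J).map (AddMonoidAlgebra.domCongr k k (Finsupp.addEquivFunOnFinite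 (ι := Fin (M + m)) (M := ℕ)).symm)) : Ideal (MvPolynomial (Fin (M + m)) k))) = Literature.RingTheory.MvPolynomial.leadingExponents (mo a) (Literature.RingTheory.GradedAlgebra.transportIdeal (K := k) (Fin.cases (1 : MvPolynomial (Fin (M + m)) k) (fun i => MvPolynomial.X i) : Fin (M + m + 1) → MvPolynomial (Fin (M + m)) k) (((Literature.AlgebraicGeometry.Tropical.linkIdeal (AddMonoidHom.compLeft (Nat.castAddMonoidHom ℤ) (Fin (M + m))) J).map (AddMonoidAlgebra.domCongr k k (Finsupp.addEquivFunOnFinite (ι := Fin (M + m)) (M := ℕ)).symm)) : Ideal (MvPolynomial (Fin (M + m)) k))) := by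
  sorry

/-- **Stub F (regularity of an adapted chart in a Gröbner cone).** Let `J ⊆ k[ℤ^n]` be schön
(`IsSchonIdeal`), `φ` a lattice automorphism (adapted coordinates of a smooth full-dimensional cone
`σ`: `σ = {Σ c_i u_i}`, `(u_i)_l = φ(e_l)_i`) and `mo` a monomial order on `k[x_0..x_n]` such that for
every weight `w = φᵀ c` (`c ∈ ℕ^n`) of `σ` the leading exponents of the standard homogenisation `I^h` of
`J ∩ k[x_1..x_n]` for the weight order "`(0,w)` min-convention, i.e. `(C, C − w_l)` max-convention, then
`mo`" coincide with those for `mo` (`σ` lies in a maximal Gröbner cone of `I^h`). Then the chart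
`k[ℕ^n] ⧸ (φ·J ∩ k[ℕ^n])` (closure of `φ·V(J)` in `𝔸ⁿ`, the affine toric chart of `σ`) is regular at
every prime. Route: Gröbner freeness of the degeneration of `I^h` along the face weights (KERNEL (P1)),
fibres = initial degenerations (P2) which are regular by schön-ness, chart × torus (P5), Matsumura 23.7
for flat local maps with regular fibre (tree), faithfully flat descent (tree). -/
theorem stub_chartRegular :
    ∀ (k : Type) [Field k] (n : ℕ) (J : Ideal (AddMonoidAlgebra k (Fin n → ℤ))), Literature.AlgebraicGeometry.Tropical.IsSchonIdeal J → ∀ (φ : (Fin n → ℤ) ≃+ (Fin n → ℤ)) (mo : MonomialOrder.{0, 0} (Fin (n + 1))), (∀ c : Fin n → ℕ, Literature.RingTheory.MvPolynomial.leadingExponents (Literature.RingTheory.MvPolynomial.weightLex (Fin.cases (Finset.univ.sup fun l : Fin n => (∑ i, (c i : ℤ) * φ (Pi.single l 1) i).toNat) (fun l : Fin n => ((Finset.univ.sup fun l : Fin n => (∑ i, (c i : ℤ) * φ (Pi.single l 1) i).toNat : ℕ) - ∑ i, (c i : ℤ) * φ (Pi.single l 1) i).toNat) : Fin (n + 1)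 → ℕ) mo) (Literature.RingTheory.GradedAlgebra.transportIdeal (K := k) (Fin.cases (1 : MvPolynomial (Fin n) k) (fun i => MvPolynomial.X i) : Fin (n + 1) → MvPolynomial (Fin n) k) (((Literature.AlgebraicGeometry.Tropical.linkIdeal (AddMonoidHom.compLeft (Nat.castAddMonoidHom ℤ) (Fin n)) J).map (AddMonoidAlgebra.domCongr k k (Finsupp.addEquivFunOnFinite (ι := Fin n) (M := ℕ)).symm)) : Ideal (MvPolynomial (Fin n) k))) = Literature.RingTheory.MvPolynomial.leadingExponents mo (Literature.RingTheory.GradedAlgebra.transportIdeal (K := k) (Fin.cases (1 : MvPolynomial (Fin n) k) (fun i => MvPolynomial.X i) : Fin (n + 1) → MvPolynomial (Fin n) k) (((Literature.AlgebraicGeometry.Tropical.linkIdeal (AddMonoidHom.compLeft (Nat.castAddMonoidHom ℤ) (Fin n)) J).map (AddMonoidAlgebra.domCongr k k (Finsupp.addEquivFunOnFinite (ι := Fin n) (M := ℕ)).symm)) : Ideal (MvPolynomial (Fin n) k)))) → ∀ (P : Ideal (AddMonoidAlgebra k (Fin n → ℕ) ⧸ Literature.AlgebraicGeometry.Tropical.linkIdeal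 (AddMonoidHom.compLeft (Nat.castAddMonoidHom ℤ) (Fin n)) (J.map (AddMonoidAlgebra.domCongr k k φ)))) [P.IsPrime], IsRegularLocalRing (Localization.AtPrime P) := by
  sorry

/-- **Stub (chart image, glue).** For `ev' : k[ℤ^n] → K`, an adapted automorphism `φ` and a vertex `a`
of the lattice-point family `A` with `A − A a ⊆ φ⁻¹(ℕ^n)` containing the dual basis: if the adapted
chart `k[ℕ^n] ⧸ (φ·ker ev' ∩ k[ℕ^n])` is regular at every prime then so is its image
`D_a = k[ev'(x^{A b − A a}) : b] ⊆ K` (first isomorphism theorem), and `D_a` contains `ev'(x^v)` for every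
`v ∈ φ⁻¹(ℕ^n)` (the differences generate the dual cone). -/
theorem stub_chartImage :
    ∀ (k : Type) [Field k] (K : Type) [Field K] [Algebra k K] (n N : ℕ) (ev' : AddMonoidAlgebra k (Fin n → ℤ) →ₐ[k] K) (φ : (Fin n → ℤ) ≃+ (Fin n → ℤ)) (A : Fin (N + 1) → (Fin n → ℤ)) (a : Fin (N + 1)), (∀ (b : Fin (N + 1)) (i : Fin n), 0 ≤ φ (A b - A a) i) → (∀ i : Fin n, ∃ b : Fin (N + 1), φ (A b - A a) = Pi.single i 1) → (∀ (P : Ideal (AddMonoidAlgebra k (Fin n → ℕ) ⧸ Literature.AlgebraicGeometry.Tropical.linkIdeal (AddMonoidHom.compLeft (Nat.castAddMonoidHom ℤ) (Fin n)) ((RingHom.ker ev'.toRingHom).map (AddMonoidAlgebra.domCongr k k φ)))) [P.IsPrime], IsRegularLocalRing (Localization.AtPrime P)) → (∀ (P : Ideal ↥(Algebra.adjoin k (Set.range fun b : Fin (N + 1) => ev' (AddMonoidAlgebra.single (A b - A a) (1 : k))))) [P.IsPrime], IsRegularLocalRing (Localization.AtPrime P)) ∧ ∀ v : Fin n → ℤ,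 (∀ i, 0 ≤ φ v i) → ev' (AddMonoidAlgebra.single v (1 : k)) ∈ Algebra.adjoin k (Set.range fun b : Fin (N + 1) => ev' (AddMonoidAlgebra.single (A b - A a) (1 : k))) := by
  sorry

/-- **Stub E+G (the closure resolves).** Let `MX` be a projective model of `K/k`, `ev' : k[ℤ^n] → K`,
`A` an injective family of lattice points whose members are rational convex combinations of the vertices
`Vert` (D2). If for every vertex `a` the chart ring `D_a = k[ev'(x^{A b − A a}) : b] ⊆ K` is regular at
every prime and carries a `k`-morphism `Spec D_a → MX.X` through which the `K`-point of `MX` factors,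
then `MX.X` has a resolution: the closure model `Z` of the `K`-point `([ev'(x^{A b})]_b, gen)` in
`ℙᴺ ×ₖ MX` (tree `ProjModel.ofClosure`) dominates `MX` (`ofClosure.homOf`), its intersection with
`D₊(z_a) × MX` is the graph of `Spec D_a → MX.X` over the closed subscheme `Spec D_a ⊆ D₊(z_a)` (image
closure of the dominant `Spec K → Spec D_a`), these opens cover `Z` by (D2), so `Z` is regular and
`Hom.hasResolution` applies. -/
theorem stub_closureResolves :
    ∀ (k : Type) [Field k] (K : Type) [Field K] [Algebra k K] (MX : Literature.AlgebraicGeometry.Resolution.ProjModel k K) (n N : ℕ) (ev' : AddMonoidAlgebra k (Fin n → ℤ) →ₐ[k] K) (A : Fin (N + 1) → (Fin n → ℤ)) (Vert : Finset (Fin (N + 1))), Function.Injective A → (∀ b : Fin (N + 1), ∃ (mlt : ℕ) (c : Fin (N + 1) → ℕ), 0 < mlt ∧ (∀ a, c a ≠ 0 → a ∈ Vert) ∧ ∑ a, c a = mlt ∧ mlt • A b = ∑ a, c a • A a) → (∀ a ∈ Vert, ∃ g : AlgebraicGeometry.Spec (CommRingCat.of ↥(Algebra.adjoin k (Set.range fun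 b : Fin (N + 1) => ev' (AddMonoidAlgebra.single (A b - A a) (1 : k))))) ⟶ MX.X, g ≫ MX.π = AlgebraicGeometry.Spec.map (CommRingCat.ofHom (algebraMap k ↥(Algebra.adjoin k (Set.range fun b : Fin (N + 1) => ev' (AddMonoidAlgebra.single (A b - A a) (1 : k)))))) ∧ AlgebraicGeometry.Spec.map (CommRingCat.ofHom (Algebra.adjoin k (Set.range fun b : Fin (N + 1) => ev' (AddMonoidAlgebra.single (A b - A a) (1 : k)))).val.toRingHom) ≫ g = MX.gen) → (∀ a ∈ Vert, ∀ (P : Ideal ↥(Algebra.adjoin k (Set.range fun b : Fin (N + 1) => ev' (AddMonoidAlgebra.single (A b - A a) (1 : k))))) [P.IsPrime], IsRegularLocalRing (Localization.AtPrime P)) → Literature.AlgebraicGeometry.Resolution.Scheme.HasResolution MX.X := by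
  sorry

/-! ## Composition -/

/-- **The line closes the crux modulo its stubs**: `SchonResolves` from B, C-glue, D, F, chart-image
and E+G, through the tree's projective reduction (`stub_projectiveIntegralSuffices`, Chow + components)
and the schön bridge `tropicalLinks_weightInitialIdeal_eq_span`. -/
theorem SchonResolves_of : SchonResolves := by
  intro p hp hS k _ _ _ X f hsep hft hqc hint
  classical
  refine WeightedThesis.ProjectiveIntegralSuffices.stub_projectiveIntegralSuffices k ?_ X f hsep hft hqc
    inferInstance
  intro n X ι hι hXint
  obtain ⟨K, _, _, MX, eX, M, d, ev, C, hprime, hdim, -, hC, hcharts⟩ :=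
    stub_veryAffineModel k n X ι hι hXint
  -- the typed Tevelev hypothesis at `(k, M, ker ev, d)`
  obtain ⟨m, G, hG, hschon⟩ := hS d k M (RingHom.ker ev.toRingHom) hprime hdim
  obtain ⟨ev', hev'1, -, hker⟩ := stub_extKernel k K M m ev G hG
  -- schön-ness of `ker ev'` in the Literature vocabulary
  generalize hT : ((fun f : AddMonoidAlgebra k (Fin M → ℤ) => (AddMonoidAlgebra.ofCoeff (f.coeff.mapDomain fun v => Fin.append v (0 : Fin m → ℤ)) : AddMonoidAlgebra k (Fin (M + m) → ℤ))) '' (↑(RingHom.ker ev.toRingHom) : Set (AddMonoidAlgebra k (Fin M → ℤ))) ∪ Set.range (fun j : Fin m => AddMonoidAlgebra.single (Fin.append (0 : Fin M → ℤ) (Pi.single j (1 : ℤ))) (1 : k) - AddMonoidAlgebra.ofCoeff ((G j).coeff.mapDomain fun v => Fin.append v (0 : Fin m → ℤ)))) = T at hschon hker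
  have hschonJ : IsSchonIdeal (RingHom.ker ev'.toRingHom) := by
    rw [hker]
    intro w
    exact (tropicalLinks_forall_prime_regular_congr
      (tropicalLinks_weightInitialIdeal_eq_span w (Ideal.span T) _)).2 (hschon w)
  -- the fan adapted to `J = ker ev'` and to the projection to `ℤ^M`
  obtain ⟨N, A, Vert, φ, idx, mo, hA, hD1a, hD1b, hD2, hD4, hGC⟩ :=
    stub_fan k M m (RingHom.ker ev'.toRingHom)
  -- regularity of the vertex chart rings and the dual-cone monomials they contain
  have hreg := fun a (ha : a ∈ Vert) =>
    stub_chartImage k K (M + m) N ev' (φ a) A a (hD1a a ha) (hD1b a ha)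
      (stub_chartRegular k (M + m) (RingHom.ker ev'.toRingHom) hschonJ (φ a) (mo a) (hGC a ha))
  -- the chart morphisms `Spec D_a → Spec C_(idx a) → X`
  have hcharts' : ∀ a ∈ Vert, ∃ g : Spec (CommRingCat.of ↥(Algebra.adjoin k (Set.range fun b : Fin (N + 1) =>
      ev' (AddMonoidAlgebra.single (A b - A a) (1 : k))))) ⟶ MX.X,
      g ≫ MX.π = Spec.map (CommRingCat.ofHom (algebraMap k ↥(Algebra.adjoin k (Set.range fun b : Fin (N + 1) =>
        ev' (AddMonoidAlgebra.single (A b - A a) (1 : k)))))) ∧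
      Spec.map (CommRingCat.ofHom (Algebra.adjoin k (Set.range fun b : Fin (N + 1) =>
        ev' (AddMonoidAlgebra.single (A b - A a) (1 : k)))).val.toRingHom) ≫ g = MX.gen := by
    intro a ha
    obtain ⟨g, hgπ, hggen⟩ := hcharts (idx a)
    -- `C (idx a) ≤ D_a`: its generators are monomials of the dual cone (D4)
    have hle : C (idx a) ≤ Algebra.adjoin k (Set.range fun b : Fin (N + 1) =>
        ev' (AddMonoidAlgebra.single (A b - A a) (1 : k))) := by
      rw [hC (idx a), Algebra.adjoin_le_iff]
      rintro _ ⟨j, rfl⟩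
      have hgen := (hreg a ha).2 (Fin.append (Fin.cases (0 : Fin M → ℤ) (fun l : Fin M => (Pi.single l 1 : Fin M → ℤ)) j -
        Fin.cases (0 : Fin M → ℤ) (fun l : Fin M => (Pi.single l 1 : Fin M → ℤ)) (idx a)) (0 : Fin m → ℤ)) (hD4 a ha j)
      have heq : ev (AddMonoidAlgebra.single (Fin.cases (0 : Fin M → ℤ) (fun l : Fin M => (Pi.single l 1 : Fin M → ℤ)) j -
          Fin.cases (0 : Fin M → ℤ) (fun l : Fin M => (Pi.single l 1 : Fin M → ℤ)) (idx a)) (1 : k)) =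
          ev' (AddMonoidAlgebra.single (Fin.append (Fin.cases (0 : Fin M → ℤ) (fun l : Fin M => (Pi.single l 1 : Fin M → ℤ)) j -
            Fin.cases (0 : Fin M → ℤ) (fun l : Fin M => (Pi.single l 1 : Fin M → ℤ)) (idx a)) (0 : Fin m → ℤ)) (1 : k)) := by
        rw [← hev'1]
        congr 1
        apply AddMonoidAlgebra.coeff_injective
        rw [AddMonoidAlgebra.coeff_ofCoeff, AddMonoidAlgebra.coeff_single, Finsupp.mapDomain_single,
          AddMonoidAlgebra.coeff_single]
      beta_reduce
      rw [heq]
      exact hgen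
    refine ⟨Spec.map (CommRingCat.ofHom (Subalgebra.inclusion hle).toRingHom) ≫ g, ?_, ?_⟩
    · rw [Category.assoc, hgπ, ← Spec.map_comp, ← CommRingCat.ofHom_comp]
      rfl
    · rw [← hggen, ← Category.assoc, ← Spec.map_comp, ← CommRingCat.ofHom_comp]
      rfl
  have hres := stub_closureResolves k K MX (M + m) N ev' A Vert hA hD2 hcharts' (fun a ha => (hreg a ha).1)
  exact Literature.AlgebraicGeometry.Resolution.Scheme.HasResolution.of_iso eX.hom hres

end Summit.ResolutionOfSingularities.ResolutionOfSingularities.Cruxes.SchonResolves.ZariskiToricClosure
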